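import Literature.MathematicalPhysics.KineticTheory.LangevinChainHormander
import Literature.MathematicalPhysics.KineticTheory.ReyBelletThomas2002
import Literature.Analysis.Distribution.BracketGeneratingGerms
import HarnessLib

/-!
# Hörmander's bracket condition for the Langevin chain with a DEGENERATE coupling (CEHR Prop. 4.1, chain case, general order)

Topic `Literature/MathematicalPhysics/KineticTheory`. Cuneo–Eckmann–Hairer–Rey-Bellet,
*Non-equilibrium steady states for networks of oscillators*, EJP **23** (2018) no. 55, Prop. 4.1
("Under Conditions C1 and C2, the system (2.2) satisfies H1"), for the CHAIN `P : OscillatorChain`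
(path graph, baths at the ends) whose nearest-neighbour coupling `V` is non-degenerate only in the
POINTWISE sense of Rey-Bellet–Thomas 2002, condition **H2** (`RBNondegenerate P.V`: for every `r`
some derivative `V⁽ᵐ⁾(r)`, `m ≥ 2`, is non-zero — CEHR Def. 2.4 with `n = 1` and `ℓ = ℓ(r)`;
Example 2.5: "Any potential of the form `V(x) = ‖x‖^r` with `r = 2, 4, 6, …` is non-degenerate").
`LangevinChainHormander.lean` proved the bracket condition for the Fokker–Planck family
`OscillatorChain.hormanderFamily = (X₀ = -Y, X_L, X_R)` only under the UNIFORM hypothesis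
`V'' ≠ 0` (order `ℓ = 1`, e.g. `pinnedChain`), using the iterated brackets `[X₀, [X₀, …, X_L]]`
alone. For a degenerate coupling such as the purely quartic `V(r) = r⁴/4` (`V''(0) = 0`,
`V'''' = 6`) the printed proof needs the further commutators
"`[∂_{q_b}, [ ⋯, [∂_{q_b}, (∂∇V)(δq) ∂_{p_v}]]] = (D^α ∇V)(δq) ∂_{p_v}`" (CEHR p. 10; RBT p. 26),
i.e. brackets BY the derived field `∂_{q_b}`, which is only a linear combination of iterated
brackets, with coefficients that are smooth functions non-vanishing NEAR the point only. Exactly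
this book-keeping is the generic germ-module toolkit of
`Literature/Analysis/Distribution/BracketGeneratingGerms.lean` (`InGermModule`, closed under
brackets by the Jacobi identity, `InGermModule.of_smul_of_ne_zero`), with which
`ReyBelletThomas2002Hormander.lean` proved RBT Prop. 4.1 for the Rey-Bellet–Thomas model on the
EXTENDED phase space. This file runs the same induction for the Langevin family on
`PhaseSpace N` (everything PROVED, no definition of a new notion, no named fact):

* `OscillatorChain.inGermModule_unitP_left` — `∂_{p_0}` (`X_L = √(γT_L) ∂_{p_0}`, `γT_L > 0`);
* `OscillatorChain.inGermModule_unitQ_of_unitP` — `∂_{p_i} ⇒ ∂_{q_i}`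
  (`DY·∂_{p_i} = ∂_{q_i} - γ 1_B(i) ∂_{p_i}`; CEHR: "`[∂_{p_v}, X̄₀] = -∂_{q_v} + γ_v ∂_{p_v}`");
* `OscillatorChain.inGermModule_hess_smul_unitP` — `∂_{q_{i'}}, ∂_{p_l} (l ≤ i') ⇒ V''(q_i - q_{i'}) ∂_{p_i}`
  for `i = i' + 1` (the tridiagonal Hessian column, CEHR eq. (e:comm));
* `OscillatorChain.lieBracket_unitQ_couplingDerivCoeff_smul` — the higher commutators `[∂_{q_{i'}}, (-1)^k V⁽ᵏ⁾(q_i - q_{i'}) ∂_{p_i}] = (-1)^{k+1} V⁽ᵏ⁺¹⁾(q_i - q_{i'}) ∂_{p_i}`;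
* `OscillatorChain.inGermModule_unitP_succ` — the non-degeneracy step (RBT **H2** at `q_i - q_{i'}`);
* `OscillatorChain.isBracketGenerating_hormanderFamily_of_rbNondegenerate` — **CEHR Prop. 4.1 for
  the chain with an RB-non-degenerate coupling, PROVED**: smooth `U, V`, `RBNondegenerate P.V`,
  `γ T_L > 0`, every `N ≥ 1`, all `T_R`;
* `OscillatorChain.hasSmoothDensity_of_integral_generator_eq_zero` — hence, from Hörmander's
  Theorem 1.1 (`Literature.Analysis.Distribution.Hormander1967_thm11`, taken as the hypothesis
  `hH`; it is proved in the tree, `Literature.Analysis.Hypoelliptic.hormander1967_thm11_proof`),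
  every finite Borel measure `μ` with `∫ L f dμ = 0` for all `f ∈ C_c^∞` has a smooth density
  (`ᵗ(L*) = L`, `hormanderTranspose_eq_generator`) — CEHR Prop. 3.2, last sentence, for weakly
  stationary measures of such chains (`γ > 0`, `T_L > 0`, `T_R ≥ 0`).

Only the LEFT bath is used for the brackets (a chain is controlled by one end, CEHR Remark 2.2);
by the symmetry of the model the right bath alone would do as well (not formalised).

## References

* N. Cuneo, J.-P. Eckmann, M. Hairer, L. Rey-Bellet, EJP **23** (2018) no. 55
  (arXiv:1712.09413): Def. 2.4, Example 2.5, §3 (H1), Prop. 3.2, Prop. 4.1 and its proof (arXiv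
  p. 10).
* L. Rey-Bellet, L. E. Thomas, Comm. Math. Phys. **225** (2002) 305–329, condition **H2** and
  Prop. 4.1 (p. 26).
* L. Hörmander, Acta Math. **119** (1967) 147–171, Thm 1.1.
-/

noncomputable section

open Set Filter VectorField Finset MeasureTheory Literature.Analysis.Distribution
open scoped ContDiff Topology

namespace Literature.MathematicalPhysics.KineticTheory.HeatConduction

variable {N : ℕ}

/-- The coordinate vectors `(e_i, 0)`, `(0, e_i)` span phase space. [folklore] -/
theorem span_unitQ_unitP_eq_top (N : ℕ) :
    Submodule.span ℝ (Set.range (unitQ (N := N)) ∪ Set.range (unitP (N := N))) = ⊤ := by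
  rw [eq_top_iff]
  rintro v -
  rw [eq_sum_unitQ_add_sum_unitP v]
  refine Submodule.add_mem _ (Submodule.sum_mem _ fun i _ => Submodule.smul_mem _ _ ?_)
    (Submodule.sum_mem _ fun i _ => Submodule.smul_mem _ _ ?_)
  · exact Submodule.subset_span (Or.inl ⟨i, rfl⟩)
  · exact Submodule.subset_span (Or.inr ⟨i, rfl⟩)

namespace OscillatorChain

variable (P : OscillatorChain)

section Brackets

variable {P} (hN : 0 < N) {T_L T_R : ℝ} (hU : ContDiff ℝ ∞ P.U) (hV : ContDiff ℝ ∞ P.V)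
include hU hV

/-- All fields of the Fokker–Planck family `(X₀ = -Y, X_L, X_R)` are smooth. [folklore] -/
theorem hormanderFamily_smooth (hN : 0 < N) (T_L T_R : ℝ) :
    ∀ o, ContDiff ℝ ∞ (P.hormanderFamily hN T_L T_R o) := by
  rintro (_ | b)
  · exact P.contDiff_adjointDrift hU hV N
  · exact contDiff_const

omit hU hV in
/-- **The left bath yields `∂_{p_0}`**: `X_L = √(γT_L) ∂_{p_0}` with `γ T_L > 0`, so the constant
field `∂_{p_0}` is in the germ module (indeed in `lieSpan`).
[cite: CuneoEckmannHairerReyBellet2018, Prop 4.1] -/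
theorem inGermModule_unitP_left (hγL : 0 < P.γ * T_L) (x₀ : PhaseSpace N) :
    InGermModule (P.hormanderFamily hN T_L T_R) x₀ (fun _ => unitP ⟨0, hN⟩) := by
  have hs : Real.sqrt (P.γ * T_L) ≠ 0 := Real.sqrt_ne_zero'.2 hγL
  have h : InGermModule (P.hormanderFamily hN T_L T_R) x₀
      ((Real.sqrt (P.γ * T_L))⁻¹ • P.hormanderFamily hN T_L T_R (some 0)) :=
    (InGermModule.mem (mem_lieSpan_of (some 0))).const_smul _
  have e : ((Real.sqrt (P.γ * T_L))⁻¹ • P.hormanderFamily hN T_L T_R (some 0)) =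
      fun _ => (unitP ⟨0, hN⟩ : PhaseSpace N) := by
    funext y
    simp [hormanderFamily, bathField, bathSite, bathTemp, smul_smul, inv_mul_cancel₀ hs]
  rwa [e] at h

/-- The bracket of a constant field `v` in the germ module with `X₀ = -Y` puts `y ↦ DY(y)·v` in
the germ module (`[v, X₀] = DX₀·v = -DY·v`). [folklore] -/
theorem inGermModule_fderiv_drift {x₀ v : PhaseSpace N}
    (hv : InGermModule (P.hormanderFamily hN T_L T_R) x₀ (fun _ => v)) :
    InGermModule (P.hormanderFamily hN T_L T_R) x₀ fun y => fderiv ℝ (P.drift N) y v := by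
  have h := hv.lieBracket (P.hormanderFamily_smooth hU hV hN T_L T_R)
    (InGermModule.mem (mem_lieSpan_of none))
  rw [show P.hormanderFamily hN T_L T_R none = P.adjointDrift N from rfl,
    lieBracket_const_left] at h
  have e : (fun y => fderiv ℝ (P.adjointDrift N) y v) =
      -(fun y => fderiv ℝ (P.drift N) y v) := by
    funext y
    have : P.adjointDrift N = fun y => -P.drift N y := rfl
    rw [this, fderiv_fun_neg]
    rfl
  rw [e] at h
  simpa using h.neg

/-- `DY(y)·∂_{p_i} = ∂_{q_i} - γ ([i = 0] + [i = N-1]) ∂_{p_i}`. [folklore] -/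
theorem fderiv_drift_unitP_eq (y : PhaseSpace N) (i : Fin N) :
    fderiv ℝ (P.drift N) y (unitP i) = unitQ i + (-(P.γ * bathWeight N i)) • (unitP i : PhaseSpace N) := by
  rw [P.fderiv_drift_apply hU hV]
  refine Prod.ext ?_ (funext fun j => ?_)
  · simp [unitQ, unitP]
  · by_cases hj : j = i
    · subst hj
      simp [unitQ, unitP]
    · simp [unitQ, unitP, hj]

/-- **Momentum ⇒ position**: if `∂_{p_i}` is in the germ module then so is `∂_{q_i}`
(CEHR: "`[∂_{p_v}, X̄₀] = -∂_{q_v} + γ_v ∂_{p_v}` … `∇_{p_v} ∈ M ⇒ ∇_{q_v} ∈ M`").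
[cite: CuneoEckmannHairerReyBellet2018, Prop 4.1] -/
theorem inGermModule_unitQ_of_unitP {x₀ : PhaseSpace N} {i : Fin N}
    (hi : InGermModule (P.hormanderFamily hN T_L T_R) x₀ (fun _ => unitP i)) :
    InGermModule (P.hormanderFamily hN T_L T_R) x₀ (fun _ => unitQ i) := by
  have h := P.inGermModule_fderiv_drift hN hU hV hi
  simp only [P.fderiv_drift_unitP_eq hU hV] at h
  have h' := h.sub (hi.const_smul (-(P.γ * bathWeight N i)))
  have e : ((fun _ : PhaseSpace N => (unitQ i : PhaseSpace N) +
      (-(P.γ * bathWeight N i)) • (unitP i : PhaseSpace N)) -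
      (-(P.γ * bathWeight N i)) • (fun _ : PhaseSpace N => (unitP i : PhaseSpace N))) =
      fun _ => unitQ i := by
    funext y
    simp only [Pi.sub_apply, Pi.smul_apply]
    abel
  rwa [e] at h'

/-- `DY(y)·∂_{q_{i'}} = -∑_l ∂²Φ/∂q_{i'}∂q_l ∂_{p_l}` (a column of the Hessian of the potential
energy). [folklore] -/
theorem fderiv_drift_unitQ_eq (y : PhaseSpace N) (i' : Fin N) :
    fderiv ℝ (P.drift N) y (unitQ i') =
      ∑ l : Fin N, (-P.hessPotential N l i' y.1) • (unitP l : PhaseSpace N) := by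
  rw [P.fderiv_drift_apply hU hV]
  refine Prod.ext ?_ (funext fun l => ?_)
  · simp [unitQ, unitP, Prod.fst_sum]
  · simp [unitQ, unitP, Prod.snd_sum, Finset.sum_apply, Pi.single_apply]

/-- **The Hessian column modulo known directions**: if `∂_{q_{i'}}` and all `∂_{p_l}`, `l ≤ i'`,
are in the germ module and `i = i' + 1`, then so is `y ↦ V''(q_i - q_{i'}) ∂_{p_i}` (the column
`-∑_l ∂²Φ/∂q_{i'}∂q_l ∂_{p_l}` is tridiagonal with the entry `-∂²Φ/∂q_{i'}∂q_i = V''(q_i - q_{i'})`;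
CEHR eq. (e:comm): "all the terms but `(∂_i ∇V_{(b,v)})(q_v - q_b)·∇_{p_v}` are of the form
`f_u(z)·∇_{p_u}` for some `u ∈ B'`"). [cite: CuneoEckmannHairerReyBellet2018, Prop 4.1] -/
theorem inGermModule_hess_smul_unitP {x₀ : PhaseSpace N} {i i' : Fin N}
    (hii' : i.val = i'.val + 1)
    (hQ : InGermModule (P.hormanderFamily hN T_L T_R) x₀ (fun _ => unitQ i'))
    (hPl : ∀ l : Fin N, l.val ≤ i'.val →
      InGermModule (P.hormanderFamily hN T_L T_R) x₀ (fun _ => unitP l)) :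
    InGermModule (P.hormanderFamily hN T_L T_R) x₀
      (fun y => deriv (deriv P.V) (y.1 i - y.1 i') • (unitP i : PhaseSpace N)) := by
  have h := P.inGermModule_fderiv_drift hN hU hV hQ
  simp only [P.fderiv_drift_unitQ_eq hU hV] at h
  have hsum : (fun y : PhaseSpace N =>
      ∑ l : Fin N, (-P.hessPotential N l i' y.1) • (unitP l : PhaseSpace N)) =
      ∑ l : Fin N, fun y => (-P.hessPotential N l i' y.1) • (unitP l : PhaseSpace N) := by
    funext y
    rw [Finset.sum_apply]
  rw [hsum, ← Finset.add_sum_erase _ _ (Finset.mem_univ i)] at h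
  have hrest : InGermModule (P.hormanderFamily hN T_L T_R) x₀
      (∑ l ∈ Finset.univ.erase i,
        fun y => (-P.hessPotential N l i' y.1) • (unitP l : PhaseSpace N)) := by
    refine InGermModule.finset_sum _ fun l hl => ?_
    have hli : l ≠ i := Finset.ne_of_mem_erase hl
    rcases Nat.lt_or_ge l.val i.val with hlt | hge
    · -- `l ≤ i'`: known direction, smooth coefficient
      have hsm : ContDiff ℝ ∞ fun y : PhaseSpace N => -P.hessPotential N l i' y.1 := by
        have hc : ContDiff ℝ ∞ fun y : PhaseSpace N => fderiv ℝ (P.drift N) y (unitQ i') :=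
          ((P.contDiff_drift hU hV N).fderiv_right (m := ∞) (by exact_mod_cast le_top)).clm_apply
            contDiff_const
        have : (fun y : PhaseSpace N => -P.hessPotential N l i' y.1) =
            fun y => ((fderiv ℝ (P.drift N) y (unitQ i')).2) l := by
          funext y
          rw [P.fderiv_drift_apply hU hV]
          simp [unitQ, Pi.single_apply]
        rw [this]
        exact (contDiff_apply ℝ ℝ l).comp (contDiff_snd.comp hc)
      exact (hPl l (by omega)).smul (Eventually.of_forall fun y => hsm.contDiffAt)
    · -- `l ≥ i + 1 = i' + 2`: the Hessian entry vanishes identically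
      have hl2 : i'.val + 2 ≤ l.val := by
        have : l.val ≠ i.val := fun e => hli (Fin.ext e)
        omega
      have : (fun y : PhaseSpace N =>
          (-P.hessPotential N l i' y.1) • (unitP l : PhaseSpace N)) = 0 := by
        funext y
        rw [P.hessPotential_eq_zero_of_le N hl2, neg_zero, zero_smul]
        rfl
      rw [this]
      exact InGermModule.zero
  have hmain := h.sub hrest
  rw [add_sub_cancel_right] at hmain
  have e : (fun y : PhaseSpace N =>
      (-P.hessPotential N i i' y.1) • (unitP i : PhaseSpace N)) =
      fun y => deriv (deriv P.V) (y.1 i - y.1 i') • (unitP i : PhaseSpace N) := by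
    funext y
    rw [P.hessPotential_succ N hii', neg_neg]
  rwa [e] at hmain

omit hU in
/-- The coupling coefficients `y ↦ (-1)^k V⁽ᵏ⁾(q_i - q_{i'})` (the derivatives of the coupling
along a bond that the higher commutators produce) are smooth. [folklore] -/
theorem contDiff_couplingDerivCoeff (k : ℕ) (i i' : Fin N) :
    ContDiff ℝ ∞ fun y : PhaseSpace N => (-1 : ℝ) ^ k * iteratedDeriv k P.V (y.1 i - y.1 i') := by
  have hk : ContDiff ℝ ∞ (iteratedDeriv k P.V) := by
    rw [iteratedDeriv_eq_iterate]; exact hV.iterate_deriv k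
  have hq : ∀ m : Fin N, ContDiff ℝ ∞ fun y : PhaseSpace N => y.1 m := fun m =>
    (contDiff_apply ℝ ℝ m).comp contDiff_fst
  exact contDiff_const.mul (hk.comp ((hq i).sub (hq i')))

omit hU in
/-- Differentiating the coefficient along `∂_{q_{i'}}` raises its order:
`∂_{q_{i'}} [(-1)^k V⁽ᵏ⁾(q_i - q_{i'})] = (-1)^{k+1} V⁽ᵏ⁺¹⁾(q_i - q_{i'})` (`i ≠ i'`). [folklore] -/
theorem hasLineDerivAt_couplingDerivCoeff (k : ℕ) {i i' : Fin N} (hii' : i ≠ i') (y : PhaseSpace N) :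
    HasLineDerivAt ℝ (fun y : PhaseSpace N => (-1 : ℝ) ^ k * iteratedDeriv k P.V (y.1 i - y.1 i'))
      ((-1 : ℝ) ^ (k + 1) * iteratedDeriv (k + 1) P.V (y.1 i - y.1 i')) y (unitQ i') := by
  unfold HasLineDerivAt
  have hk : Differentiable ℝ (iteratedDeriv k P.V) := by
    rw [iteratedDeriv_eq_iterate]; exact (hV.iterate_deriv k).differentiable (by simp)
  have hlin : HasDerivAt (fun t : ℝ => (y + t • unitQ i').1 i - (y + t • unitQ i').1 i')
      (-1) 0 := by
    simp only [unitQ_eq, add_smul_unitQ_fst, Pi.add_apply, Pi.smul_apply, Pi.single_apply,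
      if_neg hii', smul_eq_mul, mul_zero, add_zero]
    have h := ((hasDerivAt_id (0 : ℝ)).const_add (y.1 i')).const_sub (y.1 i)
    simpa using h
  have hcomp := ((hk _).hasDerivAt.comp (0 : ℝ) hlin).const_mul ((-1 : ℝ) ^ k)
  have h0 : (y + (0 : ℝ) • unitQ i').1 i - (y + (0 : ℝ) • unitQ i').1 i' = y.1 i - y.1 i' := by
    simp
  rw [h0, ← iteratedDeriv_succ] at hcomp
  refine hcomp.congr_deriv ?_
  rw [pow_succ]
  ring

omit hU in
/-- **The higher commutators** `[∂_{q_{i'}}, Z_k] = Z_{k+1}` for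
`Z_k = (-1)^k V⁽ᵏ⁾(q_i - q_{i'}) ∂_{p_i}` (CEHR: "Repeatedly taking Lie brackets with `∂_{q_b^j}`
… `(D^α ∇V_{(b,v)})(q_v - q_b)·∇_{p_v} ∈ M`"). [cite: CuneoEckmannHairerReyBellet2018, Prop 4.1] -/
theorem lieBracket_unitQ_couplingDerivCoeff_smul (k : ℕ) {i i' : Fin N} (hii' : i ≠ i') :
    VectorField.lieBracket ℝ (fun _ => (unitQ i' : PhaseSpace N))
      (fun y => ((-1 : ℝ) ^ k * iteratedDeriv k P.V (y.1 i - y.1 i')) • (unitP i : PhaseSpace N)) =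
      fun y => ((-1 : ℝ) ^ (k + 1) * iteratedDeriv (k + 1) P.V (y.1 i - y.1 i')) •
        (unitP i : PhaseSpace N) := by
  funext y
  have hd : DifferentiableAt ℝ
      (fun y : PhaseSpace N => (-1 : ℝ) ^ k * iteratedDeriv k P.V (y.1 i - y.1 i')) y :=
    ((P.contDiff_couplingDerivCoeff hV k i i').differentiable (by simp)) y
  rw [lieBracket_const_smul_const _ _ hd, ← hd.lineDeriv_eq_fderiv,
    (P.hasLineDerivAt_couplingDerivCoeff hV k hii' y).lineDeriv]

/-- All `Z_k`, `k ≥ 2`, are in the germ module once `Z_2` and `∂_{q_{i'}}` are.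
[cite: CuneoEckmannHairerReyBellet2018, Prop 4.1] -/
theorem inGermModule_couplingDerivCoeff_smul {x₀ : PhaseSpace N} {i i' : Fin N} (hii' : i ≠ i')
    (hQ : InGermModule (P.hormanderFamily hN T_L T_R) x₀ (fun _ => unitQ i'))
    (h2 : InGermModule (P.hormanderFamily hN T_L T_R) x₀
      (fun y => ((-1 : ℝ) ^ 2 * iteratedDeriv 2 P.V (y.1 i - y.1 i')) • (unitP i : PhaseSpace N)))
    (k : ℕ) (hk : 2 ≤ k) :
    InGermModule (P.hormanderFamily hN T_L T_R) x₀
      (fun y => ((-1 : ℝ) ^ k * iteratedDeriv k P.V (y.1 i - y.1 i')) • (unitP i : PhaseSpace N)) := by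
  induction k with
  | zero => omega
  | succ k ih =>
    rcases Nat.lt_or_ge k 2 with hlt | hge
    · have : k + 1 = 2 := by omega
      rw [this]; exact h2
    · rw [← P.lieBracket_unitQ_couplingDerivCoeff_smul hV k hii']
      exact hQ.lieBracket (P.hormanderFamily_smooth hU hV hN T_L T_R) (ih hge)

/-- **The non-degeneracy step**: from `∂_{q_{i'}}`, the `∂_{p_l}` (`l ≤ i'`) and RBT's **H2**
at `q_i - q_{i'}` (`i = i' + 1`) — some `V⁽ᵐ⁾(q_i - q_{i'}) ≠ 0`, `m ≥ 2` — the direction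
`∂_{p_i}` is in the germ module at `x₀` (CEHR: "It follows from the non-degeneracy assumption that
`M` is invertible … we indeed have `∇_{p_v} ∈ M`"; here `n = 1`, so one non-vanishing derivative
and a division by a coefficient non-zero near `x₀` suffice).
[cite: CuneoEckmannHairerReyBellet2018, Prop 4.1] -/
theorem inGermModule_unitP_succ (hV2 : RBNondegenerate P.V) {x₀ : PhaseSpace N}
    {i i' : Fin N} (hii' : i.val = i'.val + 1)
    (hQ : InGermModule (P.hormanderFamily hN T_L T_R) x₀ (fun _ => unitQ i'))
    (hPl : ∀ l : Fin N, l.val ≤ i'.val →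
      InGermModule (P.hormanderFamily hN T_L T_R) x₀ (fun _ => unitP l)) :
    InGermModule (P.hormanderFamily hN T_L T_R) x₀ (fun _ => unitP i) := by
  have hne : i ≠ i' := fun e => by rw [e] at hii'; omega
  -- `Z_2`
  have h2 : InGermModule (P.hormanderFamily hN T_L T_R) x₀
      (fun y => ((-1 : ℝ) ^ 2 * iteratedDeriv 2 P.V (y.1 i - y.1 i')) • (unitP i : PhaseSpace N)) := by
    have h := P.inGermModule_hess_smul_unitP hN hU hV hii' hQ hPl
    have e : (fun y : PhaseSpace N =>
        ((-1 : ℝ) ^ 2 * iteratedDeriv 2 P.V (y.1 i - y.1 i')) • (unitP i : PhaseSpace N)) =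
        fun y => deriv (deriv P.V) (y.1 i - y.1 i') • (unitP i : PhaseSpace N) := by
      funext y
      simp [iteratedDeriv_succ, iteratedDeriv_zero]
    rwa [e]
  -- H2 at the bond
  obtain ⟨m, hm, hm0⟩ := hV2 (x₀.1 i - x₀.1 i')
  have hZ := P.inGermModule_couplingDerivCoeff_smul hN hU hV hne hQ h2 m hm
  refine InGermModule.of_smul_of_ne_zero
    (Eventually.of_forall fun y => (P.contDiff_couplingDerivCoeff hV m i i').contDiffAt) ?_ hZ
  exact mul_ne_zero (pow_ne_zero _ (by norm_num)) hm0

/-- **Cuneo–Eckmann–Hairer–Rey-Bellet 2018, Proposition 4.1, for the chain with an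
RB-non-degenerate coupling, PROVED.** For an oscillator chain with smooth potentials whose
coupling `V` satisfies the pointwise non-degeneracy **H2** of Rey-Bellet–Thomas
(`RBNondegenerate P.V`; CEHR Def. 2.4 for `n = 1`, e.g. `V(r) = r⁴/4`, Example 2.5) and a genuine
left bath (`γ T_L > 0`; a chain is controlled by one end, Remark 2.2), the family
`(X₀ = -Y, X_L, X_R)` of the Fokker–Planck operator `L* = X_L² + X_R² + X₀ + 2γ` satisfies
Hörmander's bracket condition at every point of phase space, for every `N ≥ 1` and every `T_R`.
[cite: CuneoEckmannHairerReyBellet2018, Prop 4.1] -/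
theorem isBracketGenerating_hormanderFamily_of_rbNondegenerate (hV2 : RBNondegenerate P.V)
    (hγL : 0 < P.γ * T_L) :
    IsBracketGenerating (P.hormanderFamily hN T_L T_R) univ := by
  intro x₀ _
  -- every coordinate direction is in the germ module at `x₀`, by strong induction on the site
  have key : ∀ m : ℕ, ∀ i : Fin N, i.val = m →
      InGermModule (P.hormanderFamily hN T_L T_R) x₀ (fun _ => unitP i) ∧
        InGermModule (P.hormanderFamily hN T_L T_R) x₀ (fun _ => unitQ i) := by
    intro m
    induction m using Nat.strong_induction_on with
    | _ m ih =>
      intro i him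
      have hPi : InGermModule (P.hormanderFamily hN T_L T_R) x₀ (fun _ => unitP i) := by
        rcases Nat.eq_zero_or_pos m with hm | hm
        · have : i = ⟨0, hN⟩ := Fin.ext (by rw [him, hm])
          rw [this]
          exact P.inGermModule_unitP_left hN hγL x₀
        · set i' : Fin N := ⟨m - 1, by omega⟩ with hi'
          have hii' : i.val = i'.val + 1 := by simp [hi']; omega
          refine P.inGermModule_unitP_succ hN hU hV hV2 hii' (ih i'.val (by simp [hi']; omega) i' rfl).2
            fun l hl => (ih l.val (by simp [hi'] at hl; omega) l rfl).1
      exact ⟨hPi, P.inGermModule_unitQ_of_unitP hN hU hV hPi⟩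
  refine bracketSpanAt_eq_top_of_inGermModule (span_unitQ_unitP_eq_top N) ?_
  rintro v (⟨i, rfl⟩ | ⟨i, rfl⟩)
  · exact (key _ i rfl).2
  · exact (key _ i rfl).1

end Brackets

/-! ### Smooth densities of weakly stationary measures -/

/-- **CEHR Prop. 3.2 (last sentence) for chains with an RB-non-degenerate coupling, from
Hörmander's Theorem 1.1**: for smooth potentials with `RBNondegenerate P.V`, `γ > 0`, `N ≥ 1`,
`T_L > 0`, `T_R ≥ 0`, a finite Borel measure `μ` on phase space with `∫ L f dμ = 0` for all
`f ∈ C_c^∞` is, read as a distribution, a solution of `L* μ = 0`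
(`⟨L*μ, φ⟩ = ∫ Lφ dμ = 0`, `hormanderTranspose_eq_generator`), where `L* = X_L² + X_R² - Y + 2γ`
is of Hörmander's form (1.6) and satisfies the bracket condition everywhere
(`isBracketGenerating_hormanderFamily_of_rbNondegenerate`); by Theorem 1.1 (the hypothesis `hH`,
proved in the tree as `Literature.Analysis.Hypoelliptic.hormander1967_thm11_proof`) `μ` has a
smooth density. [cite: Hormander1967, Thm 1.1] [cite: CuneoEckmannHairerReyBellet2018, Prop 3.2 and Prop 4.1] -/
theorem hasSmoothDensity_of_integral_generator_eq_zero (hH : Hormander1967_thm11)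
    (hU : ContDiff ℝ ∞ P.U) (hV : ContDiff ℝ ∞ P.V) (hV2 : RBNondegenerate P.V) (hγ : 0 < P.γ)
    (hN : 0 < N) {T_L T_R : ℝ} (hL : 0 < T_L) (hR : 0 ≤ T_R)
    (μ : Measure (PhaseSpace N)) [IsFiniteMeasure μ]
    (hstat : ∀ f : PhaseSpace N → ℝ, ContDiff ℝ ∞ f → HasCompactSupport f →
      ∫ x, P.generator N T_L T_R f x ∂μ = 0) :
    HasSmoothDensity μ := by
  have hγL : 0 < P.γ * T_L := mul_pos hγ hL
  haveI := isAddHaarMeasure_volume_phaseSpace N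
  obtain ⟨g, hg, hg0, hμg⟩ := hH.exists_eq_withDensity (volume : Measure (PhaseSpace N))
    (X₀ := P.adjointDrift N) (X := P.bathField hN T_L T_R) (c := fun _ => 2 * P.γ)
    (P.contDiff_adjointDrift hU hV N) (fun _ => contDiff_const) contDiff_const
    (P.isBracketGenerating_hormanderFamily_of_rbNondegenerate hN hU hV hV2 hγL) μ
    (fun φ hφ hφc => by
      rw [P.hormanderTranspose_eq_generator hU hV hN hγL.le (mul_nonneg hγ.le hR) hφ]
      exact hstat φ hφ hφc)
  exact ⟨g, hg, hg0, hμg⟩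

/-- Hence a weak steady state (`OscillatorChain.IsSteadyState`) of such a chain is absolutely
continuous with respect to Lebesgue measure on phase space.
[cite: Hormander1967, Thm 1.1] [cite: CuneoEckmannHairerReyBellet2018, Prop 3.2 and Prop 4.1] -/
theorem absolutelyContinuous_of_isSteadyState_of_rbNondegenerate (hH : Hormander1967_thm11)
    (hU : ContDiff ℝ ∞ P.U) (hV : ContDiff ℝ ∞ P.V) (hV2 : RBNondegenerate P.V) (hγ : 0 < P.γ)
    (hN : 0 < N) {T_L T_R : ℝ} (hL : 0 < T_L) (hR : 0 ≤ T_R)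
    {μ : Measure (PhaseSpace N)} (hμ : P.IsSteadyState N T_L T_R μ) :
    μ ≪ (volume : Measure (PhaseSpace N)) := by
  obtain ⟨hprob, hstat, -⟩ := hμ
  exact (P.hasSmoothDensity_of_integral_generator_eq_zero hH hU hV hV2 hγ hN hL hR μ
    hstat).absolutelyContinuous

end OscillatorChain

end Literature.MathematicalPhysics.KineticTheory.HeatConduction
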